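import Mathlib
import HarnessLib
import Literature.MathematicalPhysics.QuantumLattice.HubbardBandSectorCountingCounts
import Summits.HubbardSuperconductivity.HubbardSuperconductivity.Theorems.KLProgrammeCountPairsOffsetDeriv
import Summits.HubbardSuperconductivity.HubbardSuperconductivity.Theorems.KLProgrammeCountPairsOffsetNondegP

/-!
# Route `KLProgramme` — support item `CountPairsOffset` (stmt-HubbardSuperconductivity-20036):
# the grid counts for an arbitrary offset — the fold ranges and the anti-diagonal depth

Verbatim ports, for the offset level function `h_P`, of the fold-range counts of
`Literature/…/HubbardBandSectorCountingCounts.lean`: the fold ranges `k w ≤ τ` / `k w ≥ 2π - τ` injected into anti-diagonal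
counts (`count_even_posP`, `count_even_negP`), the anti-diagonal fibre count keyed by `even_keyP` (`count_anti_sigmaP`), the
level counts of the diagonal function keyed by `diag_stratP` (`count_levels_diagP`), and the dyadic depth summation
(`count_anti_totalP`, using the tree's generic `dyadic_total`). The offset enters only as an additive constant.
References: G. Benfatto, A. Giuliani, V. Mastropietro, Ann. Henri Poincaré 7 (2006) 809–898, Lemma 3.1, (2.76), (2.80),
App. A2; Ann. Henri Poincaré 4 (2003) 137–193, §7. Mathematics: HOME/prover-p4/COUNTING-NOTE.md (cell gate-hubbard-kl).
-/

noncomputable section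

namespace Summit.HubbardSuperconductivity.HubbardSuperconductivity.Theorems.CountPairsOffset

set_option linter.dupNamespace false -- summit = problem name (single-conjunct summit), D-0017

open Real Set
open Literature.MathematicalPhysics.QuantumLattice Literature.MathematicalPhysics.QuantumLattice.BandSectorCounting

section Assembly

variable {a b : ℝ} (B : BandBounds a b) {μ : ℝ} (hμ : μ ∈ Icc a b)
include B hμ

/-! ## The grid counts: the fold ranges `k w ≤ τ` and `k w ≥ 2π - τ` (verbatim ports) -/

omit B hμ in
/-- **The fold range `0 < k w ≤ τ` injects into the anti-diagonal counts**:
`(a, k) ↦ (s, i) = (2a + k, k - 1)`, `σ_s = w/2 + s w/2`, `t = (i + 1) w`. -/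
theorem count_even_posP {P : ℝ × ℝ} {w δ lam τ : ℝ} (hw : 0 < w) {N : ℕ} :
    ∑ k ∈ (Finset.range N).filter (fun k : ℕ => (k : ℝ) * w ≤ τ), ((((Finset.range N).filter fun i : ℕ =>
        |hfunP μ P (w / 2 + i * w) (w / 2 + i * w + k * w)| ≤ δ ∧
        |h3P μ P (w / 2 + i * w) (w / 2 + i * w + k * w)| < lam ∧
        |h3P μ P (w / 2 + i * w + k * w) (w / 2 + i * w)| < lam).card : ℝ)) ≤
      N + ∑ s ∈ Finset.range (4 * N), ((((Finset.range ⌊τ / w⌋₊).filter fun i : ℕ =>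
        |hfunP μ P (w / 2 + s * (w / 2) - (w + i * w) / 2) (w / 2 + s * (w / 2) + (w + i * w) / 2)| ≤ δ ∧
        |GfunP μ P (w / 2 + s * (w / 2)) (w + i * w)| ≤ 2 * lam).card : ℝ)) := by
  set S := (Finset.range N).filter (fun k : ℕ => (k : ℝ) * w ≤ τ) with hS
  set f : ℕ → ℝ := fun k => ((((Finset.range N).filter fun i : ℕ =>
        |hfunP μ P (w / 2 + i * w) (w / 2 + i * w + k * w)| ≤ δ ∧
        |h3P μ P (w / 2 + i * w) (w / 2 + i * w + k * w)| < lam ∧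
        |h3P μ P (w / 2 + i * w + k * w) (w / 2 + i * w)| < lam).card : ℝ)) with hf
  have hfN : ∀ k, f k ≤ N := by
    intro k
    rw [hf]; dsimp only
    have := Finset.card_filter_le (Finset.range N) (fun i : ℕ =>
        |hfunP μ P (w / 2 + i * w) (w / 2 + i * w + k * w)| ≤ δ ∧
        |h3P μ P (w / 2 + i * w) (w / 2 + i * w + k * w)| < lam ∧
        |h3P μ P (w / 2 + i * w + k * w) (w / 2 + i * w)| < lam)
    rw [Finset.card_range] at this
    exact_mod_cast this
  have hf0 : ∀ k, 0 ≤ f k := fun k => by positivity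
  -- split off `k = 0`
  rw [← Finset.sum_filter_add_sum_filter_not S (fun k : ℕ => k = 0)]
  have h0 : ∑ k ∈ S.filter (fun k : ℕ => k = 0), f k ≤ N := by
    have hsub : S.filter (fun k : ℕ => k = 0) ⊆ {0} := by
      intro k hk; rw [Finset.mem_filter] at hk; rw [Finset.mem_singleton]; exact hk.2
    calc ∑ k ∈ S.filter (fun k : ℕ => k = 0), f k ≤ ∑ k ∈ ({0} : Finset ℕ), f k :=
          Finset.sum_le_sum_of_subset_of_nonneg hsub fun k _ _ => hf0 k
      _ = f 0 := Finset.sum_singleton _ _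
      _ ≤ N := hfN 0
  have hpos : ∑ k ∈ S.filter (fun k : ℕ => ¬ k = 0), f k ≤
      ∑ s ∈ Finset.range (4 * N), ((((Finset.range ⌊τ / w⌋₊).filter fun i : ℕ =>
        |hfunP μ P (w / 2 + s * (w / 2) - (w + i * w) / 2) (w / 2 + s * (w / 2) + (w + i * w) / 2)| ≤ δ ∧
        |GfunP μ P (w / 2 + s * (w / 2)) (w + i * w)| ≤ 2 * lam).card : ℝ)) := by
    rw [hf]
    rw [← card_filter_product_eq_sum_snd (Finset.range N) (S.filter (fun k : ℕ => ¬ k = 0)) (fun i k =>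
        |hfunP μ P (w / 2 + i * w) (w / 2 + i * w + k * w)| ≤ δ ∧
        |h3P μ P (w / 2 + i * w) (w / 2 + i * w + k * w)| < lam ∧
        |h3P μ P (w / 2 + i * w + k * w) (w / 2 + i * w)| < lam),
      ← card_filter_product_eq_sum_fst (Finset.range (4 * N)) (Finset.range ⌊τ / w⌋₊) (fun s i =>
        |hfunP μ P (w / 2 + s * (w / 2) - (w + i * w) / 2) (w / 2 + s * (w / 2) + (w + i * w) / 2)| ≤ δ ∧
        |GfunP μ P (w / 2 + s * (w / 2)) (w + i * w)| ≤ 2 * lam)]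
    norm_cast
    refine Finset.card_le_card_of_injOn (fun p : ℕ × ℕ => (2 * p.1 + p.2, p.2 - 1)) ?_ ?_
    · intro p hp
      rw [Finset.mem_coe, Finset.mem_filter, Finset.mem_product, Finset.mem_range, Finset.mem_filter, hS,
        Finset.mem_filter, Finset.mem_range] at hp
      obtain ⟨⟨ha, ⟨hkN, hkτ⟩, hk0⟩, hQ⟩ := hp
      have hk1 : 1 ≤ p.2 := Nat.one_le_iff_ne_zero.2 hk0
      rw [Finset.mem_coe, Finset.mem_filter, Finset.mem_product, Finset.mem_range, Finset.mem_range]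
      dsimp only
      refine ⟨⟨by omega, ?_⟩, ?_⟩
      · -- `p.2 - 1 < ⌊τ/w⌋₊` since `p.2 ≤ τ / w`
        have : p.2 ≤ ⌊τ / w⌋₊ := by
          rw [Nat.le_floor_iff (by
            have : (0:ℝ) ≤ p.2 * w := by positivity
            exact div_nonneg (this.trans hkτ) hw.le)]
          rw [le_div_iff₀ hw]; exact hkτ
        omega
      · have e1 : w / 2 + ((2 * p.1 + p.2 : ℕ) : ℝ) * (w / 2) - (w + ((p.2 - 1 : ℕ) : ℝ) * w) / 2 = w / 2 + p.1 * w := by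
          rw [Nat.cast_sub hk1]; push_cast; ring
        have e2 : w / 2 + ((2 * p.1 + p.2 : ℕ) : ℝ) * (w / 2) + (w + ((p.2 - 1 : ℕ) : ℝ) * w) / 2 =
            w / 2 + p.1 * w + p.2 * w := by
          rw [Nat.cast_sub hk1]; push_cast; ring
        have e3 : w + ((p.2 - 1 : ℕ) : ℝ) * w = (p.2 : ℝ) * w := by rw [Nat.cast_sub hk1]; push_cast; ring
        rw [e1, e2, e3, GfunP_eq_h3P_add]
        have e4 : w / 2 + ((2 * p.1 + p.2 : ℕ) : ℝ) * (w / 2) + (p.2 : ℝ) * w / 2 = w / 2 + p.1 * w + p.2 * w := by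
          push_cast; ring
        have e5 : w / 2 + ((2 * p.1 + p.2 : ℕ) : ℝ) * (w / 2) - (p.2 : ℝ) * w / 2 = w / 2 + p.1 * w := by
          push_cast; ring
        rw [e4, e5]
        refine ⟨hQ.1, ?_⟩
        calc _ ≤ |h3P μ P (w / 2 + p.1 * w + p.2 * w) (w / 2 + p.1 * w)| + |h3P μ P (w / 2 + p.1 * w) (w / 2 + p.1 * w + p.2 * w)| :=
              abs_add_le _ _
          _ ≤ 2 * lam := by linarith [hQ.2.1, hQ.2.2]
    · intro p hp q hq hpq
      rw [Finset.mem_coe, Finset.mem_filter, Finset.mem_product, Finset.mem_filter, hS, Finset.mem_filter] at hp hq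
      simp only [Prod.mk.injEq] at hpq
      have hp1 : 1 ≤ p.2 := Nat.one_le_iff_ne_zero.2 hp.1.2.2
      have hq1 : 1 ≤ q.2 := Nat.one_le_iff_ne_zero.2 hq.1.2.2
      have h2 : p.2 = q.2 := by omega
      have h1 : p.1 = q.1 := by omega
      exact Prod.ext h1 h2
  linarith

/-- **The fold range `k w ≥ 2π - τ` injects into the anti-diagonal counts**:
`(a, k) ↦ (s, i) = (2a + N + k, N - k - 1)`. -/
theorem count_even_negP {P : ℝ × ℝ} {w δ lam τ : ℝ} (hw : 0 < w) {N : ℕ} (hN : (N : ℝ) * w = 2 * π) :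
    ∑ k ∈ (Finset.range N).filter (fun k : ℕ => 2 * π - τ ≤ (k : ℝ) * w), ((((Finset.range N).filter fun i : ℕ =>
        |hfunP μ P (w / 2 + i * w) (w / 2 + i * w + k * w)| ≤ δ ∧
        |h3P μ P (w / 2 + i * w) (w / 2 + i * w + k * w)| < lam ∧
        |h3P μ P (w / 2 + i * w + k * w) (w / 2 + i * w)| < lam).card : ℝ)) ≤
      ∑ s ∈ Finset.range (4 * N), ((((Finset.range ⌊τ / w⌋₊).filter fun i : ℕ =>
        |hfunP μ P (w / 2 + s * (w / 2) - (w + i * w) / 2) (w / 2 + s * (w / 2) + (w + i * w) / 2)| ≤ δ ∧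
        |GfunP μ P (w / 2 + s * (w / 2)) (w + i * w)| ≤ 2 * lam).card : ℝ)) := by
  obtain ⟨h1, h2⟩ := B.level hμ
  set S := (Finset.range N).filter (fun k : ℕ => 2 * π - τ ≤ (k : ℝ) * w) with hS
  rw [← card_filter_product_eq_sum_snd (Finset.range N) S (fun i k =>
        |hfunP μ P (w / 2 + i * w) (w / 2 + i * w + k * w)| ≤ δ ∧
        |h3P μ P (w / 2 + i * w) (w / 2 + i * w + k * w)| < lam ∧
        |h3P μ P (w / 2 + i * w + k * w) (w / 2 + i * w)| < lam),
    ← card_filter_product_eq_sum_fst (Finset.range (4 * N)) (Finset.range ⌊τ / w⌋₊) (fun s i =>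
        |hfunP μ P (w / 2 + s * (w / 2) - (w + i * w) / 2) (w / 2 + s * (w / 2) + (w + i * w) / 2)| ≤ δ ∧
        |GfunP μ P (w / 2 + s * (w / 2)) (w + i * w)| ≤ 2 * lam)]
  norm_cast
  refine Finset.card_le_card_of_injOn (fun p : ℕ × ℕ => (2 * p.1 + N + p.2, N - p.2 - 1)) ?_ ?_
  · intro p hp
    rw [Finset.mem_coe, Finset.mem_filter, Finset.mem_product, Finset.mem_range, hS, Finset.mem_filter,
      Finset.mem_range] at hp
    obtain ⟨⟨ha, ⟨hkN, hkτ⟩⟩, hQ⟩ := hp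
    rw [Finset.mem_coe, Finset.mem_filter, Finset.mem_product, Finset.mem_range, Finset.mem_range]
    dsimp only
    have hk1 : p.2 + 1 ≤ N := hkN
    refine ⟨⟨by omega, ?_⟩, ?_⟩
    · have hle : ((N - p.2 : ℕ) : ℝ) * w ≤ τ := by
        rw [Nat.cast_sub hkN.le, sub_mul, hN]; linarith
      have : N - p.2 ≤ ⌊τ / w⌋₊ := by
        rw [Nat.le_floor_iff (div_nonneg ((by positivity : (0:ℝ) ≤ ((N - p.2 : ℕ) : ℝ) * w).trans hle) hw.le),
          le_div_iff₀ hw]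
        exact hle
      omega
    · have ec : ((N - p.2 - 1 : ℕ) : ℝ) = (N : ℝ) - p.2 - 1 := by
        rw [Nat.cast_sub (by omega : 1 ≤ N - p.2), Nat.cast_sub hkN.le]; push_cast; ring
      have e1 : w / 2 + ((2 * p.1 + N + p.2 : ℕ) : ℝ) * (w / 2) - (w + ((N - p.2 - 1 : ℕ) : ℝ) * w) / 2 =
          w / 2 + p.1 * w + p.2 * w := by
        rw [ec]; push_cast; ring
      have e2 : w / 2 + ((2 * p.1 + N + p.2 : ℕ) : ℝ) * (w / 2) + (w + ((N - p.2 - 1 : ℕ) : ℝ) * w) / 2 =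
          w / 2 + p.1 * w + (1 : ℤ) * (2 * π) := by
        rw [ec]; push_cast; rw [← hN]; ring
      have e3 : w + ((N - p.2 - 1 : ℕ) : ℝ) * w = ((N : ℝ) - p.2) * w := by rw [ec]; ring
      rw [e1, e2, e3, GfunP_eq_h3P_add, hfunP_add_two_pi_three h1 h2, hfunP_swap]
      have e4 : w / 2 + ((2 * p.1 + N + p.2 : ℕ) : ℝ) * (w / 2) + ((N : ℝ) - p.2) * w / 2 = w / 2 + p.1 * w + (1 : ℤ) * (2 * π) := by
        push_cast; rw [← hN]; ring
      have e5 : w / 2 + ((2 * p.1 + N + p.2 : ℕ) : ℝ) * (w / 2) - ((N : ℝ) - p.2) * w / 2 = w / 2 + p.1 * w + p.2 * w := by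
        push_cast; ring
      rw [e4, e5, h3P_add_two_pi_two h1 h2, h3P_add_two_pi_three h1 h2]
      refine ⟨hQ.1, ?_⟩
      calc _ ≤ |h3P μ P (w / 2 + p.1 * w) (w / 2 + p.1 * w + p.2 * w)| + |h3P μ P (w / 2 + p.1 * w + p.2 * w) (w / 2 + p.1 * w)| :=
            abs_add_le _ _
        _ ≤ 2 * lam := by linarith [hQ.2.1, hQ.2.2]
  · intro p hp q hq hpq
    rw [Finset.mem_coe, Finset.mem_filter, Finset.mem_product, Finset.mem_range, hS, Finset.mem_filter,
      Finset.mem_range] at hp hq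
    simp only [Prod.mk.injEq] at hpq
    have hp1 := hp.1.2.1; have hq1 := hq.1.2.1
    have h2 : p.2 = q.2 := by omega
    have h1 : p.1 = q.1 := by omega
    exact Prod.ext h1 h2


/-! ## The grid counts: the anti-diagonal fibres and the depth -/

/-- **The count along one anti-diagonal** `(σ - t/2, σ + t/2)`, `t = (i+1) w ≤ τ` (lemma L5 with the
key bound `even_key`). -/
theorem count_anti_sigmaP {P : ℝ × ℝ} {w δ lam τ η₀ σ : ℝ} (hw : 0 < w) (hδ : 0 ≤ δ) (hlam : 0 < lam) (hτ : 0 < τ)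
    (hη₀ : 0 < η₀) (hδη : δ ≤ η₀ / 2) (hlo : a ≤ μ - η₀) (hhi : μ + η₀ ≤ b)
    (hsmall : 2 * B.A2 * (η₀ / B.Dtmin + B.smax * (B.Cg * (lam + B.A2 * τ + 2 * B.smax * (η₀ / B.Dtmin)) + τ / 2)) ≤ B.hmin / 2) :
    ((((Finset.range ⌊τ / w⌋₊).filter fun i : ℕ =>
        |hfunP μ P (σ - (w + i * w) / 2) (σ + (w + i * w) / 2)| ≤ δ ∧ |GfunP μ P σ (w + i * w)| ≤ 2 * lam).card : ℝ)) ≤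
      (⌊τ / w⌋₊ * w / min (η₀ / (2 * (2 * B.A2) * τ)) (2 * lam / (8 * B.smax ^ 2 + 4 * B.A2)) + 1) *
        (2 * ((if |hfunP μ P σ σ| ≤ 2 * δ then 2 * Real.sqrt (δ / (B.hmin / 2))
          else 2 * δ * Real.sqrt (2 * (2 * B.A2)) / (B.hmin / 2 * Real.sqrt |hfunP μ P σ σ|)) / w + 1)) := by
  obtain ⟨h1, h2⟩ := B.level hμ
  have hA := B.A2_pos; have hs := B.smax_pos; have hh := B.hmin_pos
  have h := gridCount_L5 (F := fun t => hfunP μ P (σ - t / 2) (σ + t / 2))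
    (F' := fun t => Real.sin (SXP μ P (σ - t / 2) (σ + t / 2)) * (bandVX μ (σ + t / 2) - bandVX μ (σ - t / 2)) +
        Real.sin (SYP μ P (σ - t / 2) (σ + t / 2)) * (bandVY μ (σ + t / 2) - bandVY μ (σ - t / 2)))
    (G := fun t => GfunP μ P σ t) (hasDerivAt_hfunP_anti h1 h2 P σ)
    (M := 2 * B.A2) (MG := 8 * B.smax ^ 2 + 4 * B.A2) (c := B.hmin / 2) (lam := lam) (η₀ := η₀) (τ := τ) (δ := δ)
    (by positivity) (by positivity) (by positivity) hlam hτ hη₀ hδ hδη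
    (abs_anti_derivP_le B hμ P σ) (abs_GfunP_sub_le B hμ P σ)
    (fun t ht0 htτ hF hG => even_keyP B hμ ht0 htτ hlo hhi hF hG hsmall)
    hw (K₀ := ⌊τ / w⌋₊) (by
      have := Nat.floor_le (div_nonneg hτ.le hw.le) (a := τ / w)
      rwa [le_div_iff₀ hw] at this)
  simp only [zero_div, sub_zero, add_zero] at h
  exact h

/-- **Level counts of the diagonal function** `H(σ) = h(σ, σ)` on the `σ`-grid `w/2 + s w/2`,
`s < 4N`: `#{|H| ≤ η} ≤ α η/w + β √η/w + γ` for every `η > 0` (lemma L4 below `η₀/2`, trivial above).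
-/
theorem count_levels_diagP {P : ℝ × ℝ} {w η₀ η₁ η : ℝ} (hw : 0 < w) {N : ℕ} (hN : (N : ℝ) * w = 2 * π) (hη : 0 < η)
    (hη₀ : 0 < η₀) (hη₁ : 0 < η₁) (hlo : a ≤ μ - η₀) (hhi : μ + η₀ ≤ b)
    (hsmallH : (16 * B.smax ^ 2 + 8 * B.A2) * (η₀ / B.Dtmin + B.smax * (B.Cg * (η₁ / 4 + 2 * B.smax * (η₀ / B.Dtmin)))) ≤ 2 * B.hmin) :
    ((((Finset.range (4 * N)).filter fun s : ℕ => |hfunP μ P (w / 2 + s * (w / 2)) (w / 2 + s * (w / 2))| ≤ η).card : ℝ)) ≤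
      (32 * (4 * π / min (η₀ / (2 * (8 * B.smax))) (η₁ / (4 * (16 * B.smax ^ 2 + 8 * B.A2))) + 1) / η₁ + 16 * π / η₀) * η / w +
      (8 * (4 * π / min (η₀ / (2 * (8 * B.smax))) (η₁ / (4 * (16 * B.smax ^ 2 + 8 * B.A2))) + 1) / Real.sqrt (2 * B.hmin)) * Real.sqrt η / w +
      2 * (4 * π / min (η₀ / (2 * (8 * B.smax))) (η₁ / (4 * (16 * B.smax ^ 2 + 8 * B.A2))) + 1) := by
  obtain ⟨h1, h2⟩ := B.level hμ
  have hA := B.A2_pos; have hs := B.smax_pos; have hh := B.hmin_pos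
  set ℓ₄ := min (η₀ / (2 * (8 * B.smax))) (η₁ / (4 * (16 * B.smax ^ 2 + 8 * B.A2))) with hℓ₄
  have hℓ₄0 : 0 < ℓ₄ := lt_min (by positivity) (by positivity)
  set Q₄ := 4 * π / ℓ₄ + 1 with hQ₄
  have hQ₄0 : 0 < Q₄ := by positivity
  have h4N : ((4 * N : ℕ) : ℝ) * (w / 2) = 4 * π := by push_cast; linear_combination 2 * hN
  have hsq : 0 < Real.sqrt (2 * B.hmin) := Real.sqrt_pos.2 (by positivity)
  rcases le_or_gt η (η₀ / 2) with hle | hgt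
  · have h := gridCount_L4 (g := fun x => hfunP μ P x x)
      (g' := fun x => 4 * (Real.sin (SXP μ P x x) * bandVX μ x + Real.sin (SYP μ P x x) * bandVY μ x))
      (g'' := fun x => 8 * (Real.cos (SXP μ P x x) * bandVX μ x ^ 2 + Real.cos (SYP μ P x x) * bandVY μ x ^ 2) +
        4 * (Real.sin (SXP μ P x x) * bandAX μ x + Real.sin (SYP μ P x x) * bandAY μ x))
      (hasDerivAt_hfunP_diag_zero h1 h2 P) (hasDerivAt_hfunP_diag_zero_deriv h1 h2 P)
      (M₁ := 8 * B.smax) (A := 16 * B.smax ^ 2 + 8 * B.A2) (η₀ := η₀) (η₁ := η₁) (c₂ := 2 * B.hmin) (δ := η)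
      (by positivity) (by positivity) hη₀ hη₁ (by positivity) hη.le hle
      (abs_diag_derivP_le B hμ P) (abs_diag_deriv2P_le B hμ P)
      (fun z hz hz' => diag_stratP B hμ hlo hhi hz hz' hsmallH) (x₀ := w / 2) (w := w / 2) (half_pos hw) (4 * N)
    rw [h4N] at h
    refine h.trans ?_
    have hmax : max (8 * η / η₁) (2 * Real.sqrt (η / (2 * B.hmin))) ≤ 8 * η / η₁ + 2 * (Real.sqrt η / Real.sqrt (2 * B.hmin)) := by
      rw [Real.sqrt_div hη.le]
      exact max_le (by linarith [div_nonneg (Real.sqrt_nonneg η) hsq.le]) (by linarith [div_nonneg (by linarith : 0 ≤ 8 * η) hη₁.le])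
    have hdiv : max (8 * η / η₁) (2 * Real.sqrt (η / (2 * B.hmin))) / (w / 2) ≤
        (8 * η / η₁ + 2 * (Real.sqrt η / Real.sqrt (2 * B.hmin))) / (w / 2) :=
      div_le_div_of_nonneg_right hmax (by positivity)
    have hQ : 4 * π / ℓ₄ + 1 = Q₄ := rfl
    rw [hQ]
    have e : Q₄ * (2 * ((8 * η / η₁ + 2 * (Real.sqrt η / Real.sqrt (2 * B.hmin))) / (w / 2) + 1)) =
        32 * Q₄ / η₁ * η / w + 8 * Q₄ / Real.sqrt (2 * B.hmin) * Real.sqrt η / w + 2 * Q₄ := by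
      field_simp; ring
    calc Q₄ * (2 * (max (8 * η / η₁) (2 * Real.sqrt (η / (2 * B.hmin))) / (w / 2) + 1))
        ≤ Q₄ * (2 * ((8 * η / η₁ + 2 * (Real.sqrt η / Real.sqrt (2 * B.hmin))) / (w / 2) + 1)) := by
          gcongr
      _ = 32 * Q₄ / η₁ * η / w + 8 * Q₄ / Real.sqrt (2 * B.hmin) * Real.sqrt η / w + 2 * Q₄ := e
      _ ≤ _ := by
          have t1 : 0 ≤ 16 * π / η₀ * η / w := by positivity
          have t2 : (32 * Q₄ / η₁ + 16 * π / η₀) * η / w = 32 * Q₄ / η₁ * η / w + 16 * π / η₀ * η / w := by ring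
          rw [t2]; linarith
  · -- trivial count
    have hcard : ((((Finset.range (4 * N)).filter fun s : ℕ =>
        |hfunP μ P (w / 2 + s * (w / 2)) (w / 2 + s * (w / 2))| ≤ η).card : ℝ)) ≤ 8 * π / w := by
      calc _ ≤ (((Finset.range (4 * N)).card : ℝ)) := by exact_mod_cast Finset.card_filter_le _ _
        _ = 4 * N := by rw [Finset.card_range]; push_cast; ring
        _ = 8 * π / w := by field_simp; linear_combination 4 * hN
    have hb : 8 * π / w ≤ 16 * π / η₀ * η / w := by
      rw [div_le_div_iff_of_pos_right hw]
      rw [div_mul_eq_mul_div, le_div_iff₀ hη₀]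
      nlinarith [Real.pi_pos]
    have t1 : 0 ≤ 32 * Q₄ / η₁ * η / w := by positivity
    have t2 : 0 ≤ 8 * Q₄ / Real.sqrt (2 * B.hmin) * Real.sqrt η / w := by positivity
    have t3 : (32 * Q₄ / η₁ + 16 * π / η₀) * η / w = 32 * Q₄ / η₁ * η / w + 16 * π / η₀ * η / w := by ring
    rw [t3]
    linarith

/-- **Sum of the anti-diagonal counts** over the `σ`-grid, through the dyadic depth argument:
`Σ_{s<4N} E(s) ≤ (τ/ℓ₅ + 1)·2·((J+1) K_dy / w + 4N)`. -/
theorem count_anti_totalP {P : ℝ × ℝ} {w Cδ lam τ η₀ η₁ : ℝ} (hw : 0 < w) (hw1 : w ≤ 1) {N J : ℕ} (hN : (N : ℝ) * w = 2 * π)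
    (hJ : (2 : ℝ) ^ J * w = π) (hCδ : 0 < Cδ) (hlam : 0 < lam) (hτ : 0 < τ) (hη₀ : 0 < η₀) (hη₁ : 0 < η₁)
    (h2δ : Cδ * w ≤ η₀ / 2) (hlo : a ≤ μ - η₀) (hhi : μ + η₀ ≤ b)
    (heven : 2 * B.A2 * (η₀ / B.Dtmin + B.smax * (B.Cg * (lam + B.A2 * τ + 2 * B.smax * (η₀ / B.Dtmin)) + τ / 2)) ≤ B.hmin / 2)
    (hH : (16 * B.smax ^ 2 + 8 * B.A2) * (η₀ / B.Dtmin + B.smax * (B.Cg * (η₁ / 4 + 2 * B.smax * (η₀ / B.Dtmin)))) ≤ 2 * B.hmin) :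
    ∑ s ∈ Finset.range (4 * N), ((((Finset.range ⌊τ / w⌋₊).filter fun i : ℕ =>
        |hfunP μ P (w / 2 + s * (w / 2) - (w + i * w) / 2) (w / 2 + s * (w / 2) + (w + i * w) / 2)| ≤ Cδ * w ∧
        |GfunP μ P (w / 2 + s * (w / 2)) (w + i * w)| ≤ 2 * lam).card : ℝ)) ≤
      (τ / min (η₀ / (2 * (2 * B.A2) * τ)) (2 * lam / (8 * B.smax ^ 2 + 4 * B.A2)) + 1) * (2 *
        (((J : ℝ) + 1) * (2 * Real.sqrt (Cδ / (B.hmin / 2)) *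
            (2 * (32 * (4 * π / min (η₀ / (2 * (8 * B.smax))) (η₁ / (4 * (16 * B.smax ^ 2 + 8 * B.A2))) + 1) / η₁ + 16 * π / η₀) * Cδ +
              (8 * (4 * π / min (η₀ / (2 * (8 * B.smax))) (η₁ / (4 * (16 * B.smax ^ 2 + 8 * B.A2))) + 1) / Real.sqrt (2 * B.hmin)) * Real.sqrt (2 * Cδ) +
              2 * (4 * π / min (η₀ / (2 * (8 * B.smax))) (η₁ / (4 * (16 * B.smax ^ 2 + 8 * B.A2))) + 1)) +
          (2 * (32 * (4 * π / min (η₀ / (2 * (8 * B.smax))) (η₁ / (4 * (16 * B.smax ^ 2 + 8 * B.A2))) + 1) / η₁ + 16 * π / η₀) *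
              (2 * Cδ * Real.sqrt (2 * (2 * B.A2)) / (B.hmin / 2)) * Real.sqrt (Cδ * π) +
            Real.sqrt 2 * (8 * (4 * π / min (η₀ / (2 * (8 * B.smax))) (η₁ / (4 * (16 * B.smax ^ 2 + 8 * B.A2))) + 1) / Real.sqrt (2 * B.hmin)) *
              (2 * Cδ * Real.sqrt (2 * (2 * B.A2)) / (B.hmin / 2)) +
            2 * (4 * π / min (η₀ / (2 * (8 * B.smax))) (η₁ / (4 * (16 * B.smax ^ 2 + 8 * B.A2))) + 1) *
              (2 * Cδ * Real.sqrt (2 * (2 * B.A2)) / (B.hmin / 2)) / Real.sqrt Cδ) +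
          8 * π * (2 * Cδ * Real.sqrt (2 * (2 * B.A2)) / (B.hmin / 2)) / Real.sqrt (2 * Cδ * π)) / w + 4 * N)) := by
  have hA := B.A2_pos; have hs := B.smax_pos; have hh := B.hmin_pos
  set Q₄ := 4 * π / min (η₀ / (2 * (8 * B.smax))) (η₁ / (4 * (16 * B.smax ^ 2 + 8 * B.A2))) + 1 with hQ₄
  have hℓ₄ : 0 < min (η₀ / (2 * (8 * B.smax))) (η₁ / (4 * (16 * B.smax ^ 2 + 8 * B.A2))) := lt_min (by positivity) (by positivity)
  have hQ₄0 : 0 < Q₄ := by positivity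
  set X := 32 * Q₄ / η₁ + 16 * π / η₀ with hX
  set Y := 8 * Q₄ / Real.sqrt (2 * B.hmin) with hY
  set Z := 2 * Q₄ with hZ
  have hX0 : 0 ≤ X := by positivity
  have hY0 : 0 ≤ Y := by positivity
  have hZ0 : 0 ≤ Z := by positivity
  set ℓ₅ := min (η₀ / (2 * (2 * B.A2) * τ)) (2 * lam / (8 * B.smax ^ 2 + 4 * B.A2)) with hℓ₅
  have hℓ₅0 : 0 < ℓ₅ := lt_min (by positivity) (by positivity)
  set K₀ := ⌊τ / w⌋₊ with hK₀
  have hK₀τ : (K₀ : ℝ) * w ≤ τ := by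
    have := Nat.floor_le (div_nonneg hτ.le hw.le) (a := τ / w)
    rwa [le_div_iff₀ hw] at this
  set bσ : ℕ → ℝ := fun s =>
    if |hfunP μ P (w / 2 + s * (w / 2)) (w / 2 + s * (w / 2))| ≤ 2 * (Cδ * w) then 2 * Real.sqrt (Cδ * w / (B.hmin / 2))
    else 2 * (Cδ * w) * Real.sqrt (2 * (2 * B.A2)) / (B.hmin / 2 * Real.sqrt |hfunP μ P (w / 2 + s * (w / 2)) (w / 2 + s * (w / 2))|) with hbσ
  -- per-fibre bound
  have hper : ∀ s ∈ Finset.range (4 * N), ((((Finset.range K₀).filter fun i : ℕ =>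
        |hfunP μ P (w / 2 + s * (w / 2) - (w + i * w) / 2) (w / 2 + s * (w / 2) + (w + i * w) / 2)| ≤ Cδ * w ∧
        |GfunP μ P (w / 2 + s * (w / 2)) (w + i * w)| ≤ 2 * lam).card : ℝ)) ≤
      (τ / ℓ₅ + 1) * (2 * (bσ s / w + 1)) := by
    intro s _
    have h := count_anti_sigmaP B hμ (P := P) (σ := w / 2 + s * (w / 2)) hw (by positivity) hlam hτ hη₀ h2δ hlo hhi heven
    refine h.trans ?_
    have hb0 : 0 ≤ bσ s := by rw [hbσ]; dsimp only; split_ifs <;> positivity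
    have hfac : (K₀ : ℝ) * w / ℓ₅ + 1 ≤ τ / ℓ₅ + 1 := by
      have := div_le_div_of_nonneg_right hK₀τ hℓ₅0.le; linarith
    exact mul_le_mul_of_nonneg_right hfac (by positivity)
  -- the dyadic total
  have hT : (((Finset.range (4 * N)).card : ℝ)) ≤ 8 * π / w := by
    rw [Finset.card_range]; push_cast
    rw [le_div_iff₀ hw]; nlinarith
  have hdy := dyadic_total (Finset.range (4 * N)) (fun s : ℕ => |hfunP μ P (w / 2 + s * (w / 2)) (w / 2 + s * (w / 2))|)
    hw hw1 hCδ (half_pos hh) (by positivity : (0:ℝ) < 2 * B.A2) hX0 hY0 hZ0 hJ hT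
    (fun η hη => count_levels_diagP B hμ (P := P) hw hN hη hη₀ hη₁ hlo hhi hH)
  -- sum the per-fibre bounds
  calc _ ≤ ∑ s ∈ Finset.range (4 * N), (τ / ℓ₅ + 1) * (2 * (bσ s / w + 1)) := Finset.sum_le_sum hper
    _ = (τ / ℓ₅ + 1) * (2 * ((∑ s ∈ Finset.range (4 * N), bσ s) / w + 4 * N)) := by
        rw [← Finset.mul_sum, ← Finset.mul_sum, Finset.sum_add_distrib, Finset.sum_div, Finset.sum_const,
          Finset.card_range]
        simp
    _ ≤ _ := by
        apply mul_le_mul_of_nonneg_left _ (by positivity)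
        apply mul_le_mul_of_nonneg_left _ (by norm_num)
        exact add_le_add (div_le_div_of_nonneg_right hdy hw.le) le_rfl


end Assembly

end Summit.HubbardSuperconductivity.HubbardSuperconductivity.Theorems.CountPairsOffset

end
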